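import Mathlib
import Summits.KontsevichZagierPeriods.Zeta5Search.ClusterBoundProof
import HarnessLib

/-!
# ζ(5) search — ZERO EVALUATION, part 1: the reduced fraction at a pole and the polar part at a class zero

Cell `pub-zeta5` (HONEST FRAMING: systematic search; no irrationality claim unless certified), typer seat
generation 8.  Part 1 of 2 of the Lean proof of `ClusterValuation.ZeroEvaluation` (part 2 = `ZeroEvaluationProof.lean`, which discharges it BY NAME) (found and proved on paper by gen-2 g7, REPORT-gen2-g7
§2.4; g8 check 1,779 classes): in the window `p² > b₀+2`, if the residue class of `x` has a SINGLE pole `q` and every class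
point below `q` is a ZERO of `R_b` (no neutral point), then the class piece `V_x = Σ_o c_{o,q} H_q^{(o+1)}` of the constant
term is `p`-integral — although `E_x` may be as low as `−6`.

PROOF (no `p`-adic analysis; everything in `ℚ[X]`).  Only the multiples `k = mp ≤ q` of `p` in `H_q^{(σ)} = Σ_{k ≤ q} k^{−σ}`
carry denominators, and for such `k` the point `u = q − k` lies in the class below `q`, so it is a zero.  With
`G = Gser b q` (regular part at the pole, `p`-INTEGRAL coefficients by `gser_integral` since `q` is alone in its class),
pole order `κ = 6 − mult q`, and the reduced fraction `Pden · G = Pnum` (`Pden` = the OTHER poles, all in foreign classes;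
`Pnum` = centre factor × zeros), the truncation `T = (X^{mult q} G mod X^6)` satisfies `Pden·T − X^{mult q}·Pnum = X^6·H`
with `H` `p`-integral; evaluating at `X = k` where `Pnum(k) = 0` (the zero `u`):
`Σ_o c_{o,q} k^{−(o+1)} = T(k)/k^6 = H(k)/Pden(k)` and `Pden(k) = ∏_{poles s'≠q} (s'−u)^{ord}` is a `p`-adic unit.
Identities of rational numbers; nothing about irrationality.
-/

noncomputable section

open Finset PowerSeries

namespace Summit.KontsevichZagierPeriods.Zeta5Search.ClusterValuation

open Summit.KontsevichZagierPeriods.Zeta5Search.DualSeries (InBox)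
open Summit.KontsevichZagierPeriods.Zeta5Search.WedgeDictionary (IsPFData pfData isPFData_pfData exists_isPFData)
open Summit.KontsevichZagierPeriods.Zeta5Search.CasoratianValuation (InPolytope)
open Summit.KontsevichZagierPeriods.Zeta5Search.PadicSeries
open Literature.NumberTheory.Transcendental.BallRivoal (harm)

variable {p : ℕ} [hp : Fact p.Prime]

/-! ### The reduced fraction `Pden · Gser = Pnum` -/

section Poly

/-- The OTHER poles: `Pden = ∏_{s ≠ q} (X + (s−q))^{6 − mult s}` (exponent `0` at non-poles), over any ring. -/
def PdenR (R : Type*) [CommRing R] (b : ℕ → ℤ) (q : ℕ) : Polynomial R :=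
  ∏ s ∈ (range ((b 0).toNat + 1)).erase q, (Polynomial.X + Polynomial.C ((s : R) - q)) ^ (6 - mult b s)

/-- The centre factor over any ring (`cenR ℚ = cenP`). -/
def cenR (R : Type*) [CommRing R] (b : ℕ → ℤ) (q : ℕ) : Polynomial R :=
  if (2 : ℤ) ∣ b 0 then Polynomial.C 2
  else Polynomial.C 2 * Polynomial.X + Polynomial.C ((((b 0).toNat : ℕ) : R) - 2 * q)

/-- The zeros and the centre: `Pnum = cen · ∏_{s ≠ q} (X + (s−q))^{mult s − 6}` (exponent `0` at poles), over any ring. -/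
def PnumR (R : Type*) [CommRing R] (b : ℕ → ℤ) (q : ℕ) : Polynomial R :=
  cenR R b q * ∏ s ∈ (range ((b 0).toNat + 1)).erase q, (Polynomial.X + Polynomial.C ((s : R) - q)) ^ (mult b s - 6)

omit hp in
/-- `cenR ℚ = cenP`. -/
theorem cenR_rat (b : ℕ → ℤ) (q : ℕ) : cenR ℚ b q = cenP b q := rfl

omit hp in
/-- `Pden` over `ℚ` is the image of `Pden` over `ℤ`. -/
theorem PdenR_map (b : ℕ → ℤ) (q : ℕ) : (PdenR ℤ b q).map (Int.castRingHom ℚ) = PdenR ℚ b q := by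
  simp only [PdenR, Polynomial.map_prod, Polynomial.map_pow, Polynomial.map_add, Polynomial.map_C, Polynomial.map_X]
  simp only [map_sub, map_natCast]

omit hp in
/-- `Pnum` over `ℚ` is the image of `Pnum` over `ℤ`. -/
theorem PnumR_map (b : ℕ → ℤ) (q : ℕ) : (PnumR ℤ b q).map (Int.castRingHom ℚ) = PnumR ℚ b q := by
  unfold PnumR cenR
  split_ifs <;>
  · simp only [Polynomial.map_mul, Polynomial.map_prod, Polynomial.map_pow, Polynomial.map_add, Polynomial.map_C,
      Polynomial.map_X]
    simp only [map_sub, map_natCast, map_mul, map_ofNat]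

/-- Coefficients of an integer polynomial are `p`-integral. -/
theorem padicNorm_coeff_map_le_one (P : Polynomial ℤ) (i : ℕ) :
    padicNorm p ((P.map (Int.castRingHom ℚ)).coeff i) ≤ 1 := by
  rw [Polynomial.coeff_map]
  exact padicNorm.of_int _

/-- Evaluation of a polynomial with `p`-integral coefficients at a natural number is `p`-integral. -/
theorem padicNorm_eval_le_one {P : Polynomial ℚ} (hP : ∀ i, padicNorm p (P.coeff i) ≤ 1) (k : ℕ) :
    padicNorm p (P.eval (k : ℚ)) ≤ 1 := by
  rw [Polynomial.eval_eq_sum_range]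
  refine padicNorm.sum_le' (fun i _ => ?_) zero_le_one
  rw [padicNorm.mul]
  have hk : padicNorm p ((k : ℚ) ^ i) ≤ 1 := by
    have := padicNorm.of_nat (p := p) (k ^ i)
    simpa using this
  calc padicNorm p (P.coeff i) * padicNorm p ((k : ℚ) ^ i) ≤ 1 * 1 :=
        mul_le_mul (hP i) hk (padicNorm.nonneg _) zero_le_one
    _ = 1 := one_mul _

end Poly

/-- One position: `(X+δ)^{6−a} · ((X+δ)^a · ((X+δ)^6)⁻¹) = (X+δ)^{a−6}` (`δ ≠ 0`, truncated subtractions). -/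
theorem linS_factor_reduce {δ : ℚ} (hδ : δ ≠ 0) (a : ℕ) :
    linS δ ^ (6 - a) * (linS δ ^ a * (linS δ ^ 6)⁻¹) = linS δ ^ (a - 6) := by
  have h6 : constantCoeff (linS δ ^ 6) ≠ 0 := by rw [constantCoeff_linS_pow]; exact pow_ne_zero _ hδ
  rcases le_or_gt a 6 with ha | ha
  · rw [show a - 6 = 0 by omega, pow_zero, ← mul_assoc, ← pow_add, show 6 - a + a = 6 by omega,
      PowerSeries.mul_inv_cancel _ h6]
  · rw [show 6 - a = 0 by omega, pow_zero, one_mul, linS_pow_mul_inv hδ ha.le]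

/-- **`Pden · Gser = Pnum`** in `ℚ⟦X⟧`. -/
theorem coe_PdenR_mul_Gser (b : ℕ → ℤ) (q : ℕ) :
    ((PdenR ℚ b q : Polynomial ℚ) : PowerSeries ℚ) * Gser b q = (PnumR ℚ b q : Polynomial ℚ) := by
  have hD : ((PdenR ℚ b q : Polynomial ℚ) : PowerSeries ℚ) =
      ∏ s ∈ (range ((b 0).toNat + 1)).erase q, linS ((s : ℚ) - q) ^ (6 - mult b s) := by
    rw [PdenR, ← Polynomial.coeToPowerSeries.ringHom_apply, map_prod]
    simp only [map_pow, Polynomial.coeToPowerSeries.ringHom_apply, coe_X_add_C]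
  have hP : ((∏ s ∈ (range ((b 0).toNat + 1)).erase q,
      (Polynomial.X + Polynomial.C ((s : ℚ) - q)) ^ (mult b s - 6) : Polynomial ℚ) : PowerSeries ℚ) =
        ∏ s ∈ (range ((b 0).toNat + 1)).erase q, linS ((s : ℚ) - q) ^ (mult b s - 6) := by
    rw [← Polynomial.coeToPowerSeries.ringHom_apply, map_prod]
    simp only [map_pow, Polynomial.coeToPowerSeries.ringHom_apply, coe_X_add_C]
  have hN : ((PnumR ℚ b q : Polynomial ℚ) : PowerSeries ℚ) = (cenP b q : PowerSeries ℚ) *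
      ∏ s ∈ (range ((b 0).toNat + 1)).erase q, linS ((s : ℚ) - q) ^ (mult b s - 6) := by
    rw [PnumR, cenR_rat, Polynomial.coe_mul, hP]
  rw [hD, hN, Gser, mul_left_comm, ← prod_mul_distrib]
  congr 1
  refine prod_congr rfl fun s hs => ?_
  have hsq : s ≠ q := (mem_erase.1 hs).1
  exact linS_factor_reduce (sub_ne_zero.2 (by exact_mod_cast hsq)) _

/-! ### The polar part of the pole `q` evaluated at a class zero is `p`-integral -/

section Polar

/-- The truncation of `X^{mult q} · Gser` below degree `6`, as a polynomial. -/
def truncP (b : ℕ → ℤ) (q : ℕ) : Polynomial ℚ :=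
  ∑ i ∈ range 6, Polynomial.C (PowerSeries.coeff i (PowerSeries.X ^ mult b q * Gser b q)) * Polynomial.X ^ i

omit hp in
/-- Coefficients of the truncation. -/
theorem coeff_truncP (b : ℕ → ℤ) (q i : ℕ) :
    (truncP b q).coeff i = if i < 6 then PowerSeries.coeff i (PowerSeries.X ^ mult b q * Gser b q) else 0 := by
  rw [truncP, Polynomial.finsetSum_coeff]
  split_ifs with hi
  · rw [sum_eq_single i]
    · rw [Polynomial.coeff_C_mul, Polynomial.coeff_X_pow, if_pos rfl, mul_one]
    · intro j _ hji
      rw [Polynomial.coeff_C_mul, Polynomial.coeff_X_pow, if_neg (Ne.symm hji), mul_zero]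
    · intro h; exact absurd (mem_range.2 hi) h
  · refine sum_eq_zero fun j hj => ?_
    have : i ≠ j := by have := mem_range.1 hj; omega
    rw [Polynomial.coeff_C_mul, Polynomial.coeff_X_pow, if_neg this, mul_zero]

omit hp in
/-- `X^6 ∣ Pden · T − X^{mult q} · Pnum` in `ℚ[X]`. -/
theorem X_pow_six_dvd (b : ℕ → ℤ) (q : ℕ) :
    (Polynomial.X : Polynomial ℚ) ^ 6 ∣ PdenR ℚ b q * truncP b q - Polynomial.X ^ mult b q * PnumR ℚ b q := by
  rw [Polynomial.X_pow_dvd_iff]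
  intro d hd
  -- pass to power series, where `Pden · (X^μ G) = X^μ Pnum`
  have hps : (((PdenR ℚ b q * truncP b q - Polynomial.X ^ mult b q * PnumR ℚ b q : Polynomial ℚ)) : PowerSeries ℚ) =
      ((PdenR ℚ b q : Polynomial ℚ) : PowerSeries ℚ) *
        ((truncP b q : PowerSeries ℚ) - PowerSeries.X ^ mult b q * Gser b q) := by
    rw [Polynomial.coe_sub, Polynomial.coe_mul, Polynomial.coe_mul, Polynomial.coe_pow, Polynomial.coe_X, mul_sub,
      mul_left_comm, coe_PdenR_mul_Gser]
  have hX : (PowerSeries.X : PowerSeries ℚ) ^ 6 ∣ (truncP b q : PowerSeries ℚ) - PowerSeries.X ^ mult b q * Gser b q := by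
    rw [PowerSeries.X_pow_dvd_iff]
    intro m hm
    rw [map_sub, Polynomial.coeff_coe, coeff_truncP, if_pos hm, sub_self]
  have h := (hX.mul_left ((PdenR ℚ b q : Polynomial ℚ) : PowerSeries ℚ))
  rw [← hps, PowerSeries.X_pow_dvd_iff] at h
  have := h d hd
  rwa [Polynomial.coeff_coe] at this

omit hp in
/-- `Pnum(q − u) = 0` at a class zero `u ≠ q` (`mult u ≥ 7`). -/
theorem PnumR_eval_eq_zero (b : ℕ → ℤ) {q u : ℕ} (hu : u ≤ (b 0).toNat) (huq : u ≠ q) (hzero : 7 ≤ mult b u) :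
    (PnumR ℚ b q).eval ((q : ℚ) - u) = 0 := by
  rw [PnumR, Polynomial.eval_mul, Polynomial.eval_prod]
  refine mul_eq_zero_of_right _ (prod_eq_zero (mem_erase.2 ⟨huq, mem_range.2 (by omega)⟩) ?_)
  rw [Polynomial.eval_pow, Polynomial.eval_add, Polynomial.eval_X, Polynomial.eval_C,
    show (q : ℚ) - u + ((u : ℚ) - q) = 0 by ring, zero_pow (by omega)]

/-- `Pden(q − u)` is a `p`-adic unit when `u ≡ q` and the class of `q` has no other pole. -/
theorem padicNorm_PdenR_eval (b : ℕ → ℤ) {q u : ℕ} (hu : u ≤ (b 0).toNat) (hn : (b 0).toNat < p ^ 2) (hdvd : (p : ℤ) ∣ (q : ℤ) - u)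
    (hreg : ∀ s, s ≤ (b 0).toNat → s ≠ q → (p : ℤ) ∣ (s : ℤ) - q → 6 ≤ mult b s) :
    padicNorm p ((PdenR ℚ b q).eval ((q : ℚ) - u)) = 1 := by
  rw [PdenR, Polynomial.eval_prod]
  -- each factor is a unit
  have hfac : ∀ s ∈ (range ((b 0).toNat + 1)).erase q,
      padicNorm p (((Polynomial.X + Polynomial.C ((s : ℚ) - q)) ^ (6 - mult b s)).eval ((q : ℚ) - u)) = 1 := by
    intro s hs
    have hs' := mem_erase.1 hs
    have hsn : s ≤ (b 0).toNat := Nat.lt_succ_iff.1 (mem_range.1 hs'.2)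
    rw [Polynomial.eval_pow, Polynomial.eval_add, Polynomial.eval_X, Polynomial.eval_C,
      show (q : ℚ) - u + ((s : ℚ) - q) = (s : ℚ) - u by ring]
    rcases le_or_gt 6 (mult b s) with hm | hm
    · rw [show 6 - mult b s = 0 by omega, pow_zero, padicNorm.one]
    · -- `s` is a pole, hence in a foreign class: `p ∤ s − u`
      have hndvd : ¬ (p : ℤ) ∣ (s : ℤ) - u := by
        intro h
        have : (p : ℤ) ∣ (s : ℤ) - q := by
          have := h.sub hdvd
          have e : (s : ℤ) - u - ((q : ℤ) - u) = (s : ℤ) - q := by ring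
          rwa [e] at this
        have := hreg s hsn hs'.1 this
        omega
      have hsu : s ≠ u := by rintro rfl; exact hndvd (by simp)
      have hnorm := padicNorm_sub_eq (p := p) hsn hu hsu hn
      rw [if_neg hndvd, neg_zero, zpow_zero] at hnorm
      have : padicNorm p (((s : ℚ) - u) ^ (6 - mult b s)) = padicNorm p ((s : ℚ) - u) ^ (6 - mult b s) := by
        induction (6 - mult b s) with
        | zero => simp
        | succ m ih => rw [pow_succ, padicNorm.mul, ih, pow_succ]
      rw [this, hnorm, one_pow]
  -- product of units
  have key : ∀ (S : Finset ℕ), S ⊆ (range ((b 0).toNat + 1)).erase q →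
      padicNorm p (∏ s ∈ S, ((Polynomial.X + Polynomial.C ((s : ℚ) - q)) ^ (6 - mult b s)).eval ((q : ℚ) - u)) = 1 := by
    intro S hS
    induction S using Finset.induction_on with
    | empty => simp
    | insert a S ha ih =>
      rw [prod_insert ha, padicNorm.mul, hfac a (hS (mem_insert_self a S)), ih (fun s hs => hS (mem_insert_of_mem hs)),
        one_mul]
  exact key _ Subset.rfl

/-- **The polar part at a class zero is `p`-integral**: for a multiple `k` of `p` with `1 ≤ k ≤ q` such that
`u = q − k` is a zero of `R_b`, and `q` alone among the poles of its class, `‖Σ_{o<6} c_{o,q} k^{−(o+1)}‖_p ≤ 1`. -/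
theorem padicNorm_polar_le_one (b : ℕ → ℤ) (hb : InPolytope b) {q k : ℕ} (hq : q ≤ (b 0).toNat)
    (hn : (b 0).toNat < p ^ 2) (hp2 : p ≠ 2) (hk1 : 1 ≤ k) (hkq : k ≤ q) (hpk : (p : ℤ) ∣ (k : ℤ))
    (hzero : 7 ≤ mult b (q - k))
    (hreg : ∀ s, s ≤ (b 0).toNat → s ≠ q → (p : ℤ) ∣ (s : ℤ) - q → 6 ≤ mult b s) :
    padicNorm p (∑ o ∈ range 6, pfData b o q / (k : ℚ) ^ (o + 1)) ≤ 1 := by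
  obtain ⟨hbox, h2, h3⟩ := hb
  have hhalf : ∀ j ∈ range 7, 2 * b (j + 1) ≤ b 0 + 1 := fun j hj => by have := h2 j hj; omega
  obtain ⟨c, hc⟩ := exists_isPFData b hbox (by omega)
  have hpf := isPFData_pfData hc
  set u := q - k with hu
  have huq : (k : ℚ) = (q : ℚ) - u := by
    have : u + k = q := by omega
    have : ((u + k : ℕ) : ℚ) = q := by exact_mod_cast this
    push_cast at this; linarith
  have hk0 : (k : ℚ) ≠ 0 := by exact_mod_cast (show k ≠ 0 by omega)
  -- Step 1: the sum is `T(k)/k^6`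
  have hsum : ∑ o ∈ range 6, pfData b o q / (k : ℚ) ^ (o + 1) = (truncP b q).eval (k : ℚ) / (k : ℚ) ^ 6 := by
    set f : ℕ → ℚ := fun i =>
      PowerSeries.coeff i (PowerSeries.X ^ mult b q * Gser b q) * (k : ℚ) ^ i / (k : ℚ) ^ 6 with hf
    have hL : ∀ o ∈ range 6, pfData b o q / (k : ℚ) ^ (o + 1) = f (6 - 1 - o) := by
      intro o ho
      have ho' := mem_range.1 ho
      simp only [hf, pf_eq_coeff_Gser b hbox hhalf hpf hq ho', show 6 - 1 - o = 5 - o by omega]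
      rw [div_eq_div_iff (pow_ne_zero _ hk0) (pow_ne_zero _ hk0), mul_assoc, ← pow_add,
        show 5 - o + (o + 1) = 6 by omega]
    rw [sum_congr rfl hL, sum_range_reflect f 6, truncP, Polynomial.eval_finsetSum, sum_div]
    refine sum_congr rfl fun i _ => ?_
    simp only [hf, Polynomial.eval_mul, Polynomial.eval_C, Polynomial.eval_pow, Polynomial.eval_X]
  -- Step 2: `Pden T − X^μ Pnum = X^6 H`, evaluate at `k`
  obtain ⟨H, hH⟩ := X_pow_six_dvd b q
  have hregN : ∀ s, s ≤ (b 0).toNat → s ≠ q → (p : ℤ) ∣ (s : ℤ) - q → 0 ≤ netExp b s := by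
    intro s hs hsq hdvd
    have := hreg s hs hsq hdvd
    have := mult_eq_netExp b s
    omega
  have hG : CoeffBound p 0 0 (Gser b q) := gser_integral b hq hn hp2 hregN
  have heval := congrArg (fun P => P.eval (k : ℚ)) hH
  simp only [Polynomial.eval_sub, Polynomial.eval_mul, Polynomial.eval_pow, Polynomial.eval_X] at heval
  have hPnum : (PnumR ℚ b q).eval (k : ℚ) = 0 := by
    rw [huq]
    exact PnumR_eval_eq_zero b (by omega) (by omega) hzero
  rw [hPnum, mul_zero, sub_zero] at heval
  -- heval : Pden(k) * T(k) = k^6 * H(k)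
  have hPden : padicNorm p ((PdenR ℚ b q).eval (k : ℚ)) = 1 := by
    rw [huq]
    refine padicNorm_PdenR_eval b (by omega) hn ?_ hreg
    have : (q : ℤ) - ((u : ℕ) : ℤ) = k := by omega
    rw [this]; exact hpk
  have hPden0 : (PdenR ℚ b q).eval (k : ℚ) ≠ 0 := by
    intro h; rw [h, padicNorm.zero] at hPden; exact zero_ne_one hPden
  have hT : (truncP b q).eval (k : ℚ) / (k : ℚ) ^ 6 = H.eval (k : ℚ) / (PdenR ℚ b q).eval (k : ℚ) := by
    rw [div_eq_div_iff (pow_ne_zero _ hk0) hPden0]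
    linear_combination heval
  rw [hsum, hT, padicNorm.div, hPden, div_one]
  -- Step 3: `H` has `p`-integral coefficients
  refine padicNorm_eval_le_one (fun i => ?_) k
  have hcoef : H.coeff i = (PdenR ℚ b q * truncP b q - Polynomial.X ^ mult b q * PnumR ℚ b q).coeff (i + 6) := by
    rw [hH, Polynomial.coeff_X_pow_mul]
  rw [hcoef, Polynomial.coeff_sub, Polynomial.coeff_mul, Polynomial.coeff_X_pow_mul']
  refine (padicNorm.sub (p := p)).trans (max_le ?_ ?_)
  · refine padicNorm.sum_le' (fun ij _ => ?_) zero_le_one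
    rw [padicNorm.mul]
    have h1 : padicNorm p ((PdenR ℚ b q).coeff ij.1) ≤ 1 := by
      rw [← PdenR_map]; exact padicNorm_coeff_map_le_one _ _
    have h2' : padicNorm p ((truncP b q).coeff ij.2) ≤ 1 := by
      rw [coeff_truncP]
      split_ifs with hlt
      · rw [PowerSeries.coeff_X_pow_mul']
        split_ifs with hle
        · simpa using hG (ij.2 - mult b q)
        · rw [padicNorm.zero]; exact zero_le_one
      · rw [padicNorm.zero]; exact zero_le_one
    calc padicNorm p ((PdenR ℚ b q).coeff ij.1) * padicNorm p ((truncP b q).coeff ij.2) ≤ 1 * 1 :=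
          mul_le_mul h1 h2' (padicNorm.nonneg _) zero_le_one
      _ = 1 := one_mul _
  · split_ifs with hle
    · rw [← PnumR_map]; exact padicNorm_coeff_map_le_one _ _
    · rw [padicNorm.zero]; exact zero_le_one

end Polar

end Summit.KontsevichZagierPeriods.Zeta5Search.ClusterValuation

end
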